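import Summits.Ventures.HodgeRepro.SexticFaces
import Summits.Ventures.HodgeRepro.FaceCriterion

/-!
# Completeness of the sealed degree-6 census: every `SumTwo` quadruple without a conjugate pair is a face

Blind re-derivation cell `pub-hodge-repro`, seat `typer` (gen 4).  Continues `SexticFaces.lean` /
`FaceCriterion.lean`.

The sealed `Statements.lean` §A.3 lists the `48` faces `(Φ; p, p′)` (`p ≠ p′ ∈ {0, 1, 2}`) of the cyclic
sextic field and proves `SumTwo` for each of them (clause (2), `census_sumTwo_structural`).  This file
proves the CONVERSE in the sealed coordinates — the structural reason behind `route/ROUTE.md` §3.5 (ii)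
"the programme's census is complete for degrees 6 and 8":

* **`sealed_face_of_sumTwo`**: if four sealed CM types `T 0, …, T 3 ∈ cmTypes` satisfy the sealed count
  (every `i : ℤ/6` lies in exactly two of them) and none of `T 1, T 2, T 3` is the conjugate `bar (T 0)`,
  then there are places `p, p′` with `(T 0, p, p′) ∈ faces` and `T 1, T 2, T 3` are, in some order, the
  sealed corners `flip p (bar (T 0))`, `flip p′ (bar (T 0))`, `flip p′ (flip p (T 0))`;
* **`sealed_corners_perm_of_sumTwo`**: the same as a `List.Perm`: the sealed corner list of that face is a
  permutation of `[T 0, T 1, T 2, T 3]`.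

Both are instances of `isFace_of_sumTwo_of_card_le_eight` (`FaceCriterion.lean`, valid for every Galois CM
field of degree `≤ 8`) read through the `SexticBridge` dictionary; the only degree-6 specifics are the
sealed place representatives `{0, 1, 2}` (`rep`).
-/

open Finset
open scoped Pointwise

namespace HodgeRepro

namespace SexticBridge

open Summit.Ventures.HodgeRepro.FaceCensus.Sextic
open Multiplicative

/-! ### Place representatives -/

/-- The sealed representative in `{0, 1, 2}` of the place `{p, p + 3}`: `p` itself or `p + 3`. -/
def rep (p : ZMod 6) : ZMod 6 := if p ∈ ({0, 1, 2} : Finset (ZMod 6)) then p else p + 3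

/-- `rep p ∈ {0, 1, 2}`. -/
theorem rep_mem (p : ZMod 6) : rep p ∈ ({0, 1, 2} : Finset (ZMod 6)) := by
  revert p; decide

/-- `rep p` represents the place of `p`: `{rep p, rep p + 3} = {p, p + 3}`. -/
theorem place_rep (p : ZMod 6) : ({rep p, rep p + 3} : Finset (ZMod 6)) = {p, p + 3} := by
  revert p; decide

/-- The sealed flip at `rep p` is the sealed flip at `p`. -/
theorem flip_rep (p : ZMod 6) (T : Finset (ZMod 6)) :
    Coordinates.flip (rep p) T = Coordinates.flip p T := by
  unfold Coordinates.flip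
  rw [place_rep]

/-- Distinct places have distinct representatives. -/
theorem rep_ne (p p' : ZMod 6) (h1 : p' ≠ p) (h2 : p' ≠ p + 3) : rep p ≠ rep p' := by
  revert p p'; decide

/-- `π′ ∉ place c π` in the model says `p′ ≠ p` and `p′ ≠ p + 3` for the coordinates `p = toAdd π`,
`p′ = toAdd π′`. -/
theorem not_mem_place_iff (π π' : C6) :
    π' ∉ place cc_C6 π ↔ toAdd π' ≠ toAdd π ∧ toAdd π' ≠ toAdd π + 3 := by
  revert π π'; decide

/-! ### Completeness -/

/-- **Completeness of the sealed degree-6 census (explicit form).**  Four sealed CM types with the sealed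
`SumTwo` count and no corner conjugate to `T 0` are a sealed face: `(T 0, p, p′) ∈ faces`, and `T a, T b,
T d` (the three corners other than `0`) are its sealed corners `flip p (bar (T 0))`,
`flip p′ (bar (T 0))`, `flip p′ (flip p (T 0))`. -/
theorem sealed_face_of_sumTwo (T : Fin 4 → Finset (ZMod 6)) (hT : ∀ k, T k ∈ Coordinates.cmTypes)
    (hsum : ∀ i : ZMod 6, (univ.filter fun k => i ∈ T k).card = 2)
    (hconj : ∀ k, k ≠ 0 → T k ≠ Coordinates.bar (T 0)) :
    ∃ p p' : ZMod 6, (T 0, p, p') ∈ Coordinates.faces ∧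
      ∃ a b d : Fin 4, a ≠ 0 ∧ b ≠ 0 ∧ d ≠ 0 ∧ a ≠ b ∧ a ≠ d ∧ b ≠ d ∧
        T a = Coordinates.flip p (Coordinates.bar (T 0)) ∧
        T b = Coordinates.flip p' (Coordinates.bar (T 0)) ∧
        T d = Coordinates.flip p' (Coordinates.flip p (T 0)) := by
  have hT' : ∀ k, IsCMType cc_C6 (toC6 (T k)) := fun k => (mem_cmTypes_iff _).1 (hT k)
  have hsum' : SumTwo fun k => toC6 (T k) := by
    intro x
    have := hsum (toAdd x)
    simpa [mem_toC6] using this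
  have hconj' : ∀ k, k ≠ 0 → toC6 (T k) ≠ cc_C6 • toC6 (T 0) := by
    intro k hk h
    apply hconj k hk
    apply toC6_injective
    rw [toC6_bar]
    exact h
  obtain ⟨a, b, d, π, π', ha, hb, hd, hab, had, hbd, -, -, hππ', h1, h2, h3⟩ :=
    isFace_of_sumTwo_of_card_le_eight cc_C6_isComplexConj hT' hsum' hconj' (by rw [card_C6]; omega)
  simp only [faceCorners] at h1 h2 h3
  rw [not_mem_place_iff] at hππ'
  refine ⟨rep (toAdd π), rep (toAdd π'), ?_, a, b, d, ha, hb, hd, hab, had, hbd, ?_, ?_, ?_⟩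
  · rw [mem_faces_iff]
    exact ⟨hT 0, rep_mem _, rep_mem _, rep_ne _ _ hππ'.1 hππ'.2⟩
  · apply toC6_injective
    rw [flip_rep, toC6_flip', toC6_bar]
    exact h1
  · apply toC6_injective
    rw [flip_rep, toC6_flip', toC6_bar]
    exact h2
  · apply toC6_injective
    rw [flip_rep, flip_rep, toC6_flip', toC6_flip']
    exact h3

/-- **Completeness of the sealed degree-6 census (list form).**  Under the same hypotheses the sealed
corner list `corners (T 0) p p′` of a sealed face `(T 0, p, p′)` is a permutation of `[T 0, T 1, T 2, T 3]`. -/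
theorem sealed_corners_perm_of_sumTwo (T : Fin 4 → Finset (ZMod 6))
    (hT : ∀ k, T k ∈ Coordinates.cmTypes)
    (hsum : ∀ i : ZMod 6, (univ.filter fun k => i ∈ T k).card = 2)
    (hconj : ∀ k, k ≠ 0 → T k ≠ Coordinates.bar (T 0)) :
    ∃ f ∈ Coordinates.faces, f.1 = T 0 ∧
      (Coordinates.corners f.1 f.2.1 f.2.2).Perm [T 0, T 1, T 2, T 3] := by
  obtain ⟨p, p', hf, a, b, d, ha, hb, hd, hab, had, hbd, h1, h2, h3⟩ :=
    sealed_face_of_sumTwo T hT hsum hconj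
  refine ⟨(T 0, p, p'), hf, rfl, ?_⟩
  simp only [Coordinates.corners]
  rw [← h3, ← h1, ← h2]
  exact perm_fin4 T a b d ha hb hd hab had hbd

end SexticBridge

end HodgeRepro
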